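import Literature.NumberTheory.EllipticCurves.Rank1Residual.Typed.CasselsLowerBound
import Literature.NumberTheory.EllipticCurves.Rank1Residual.X1MainConjecture
import HarnessLib

/-!
# Class X1 ∩ {r = 0}, `p ∣ #Ш_an`: `BSD(E,p)` and Mazur's main conjecture from PUBLISHED theorems plus
# the finite certificate `Ш(E')[p] ≠ 0` on a curve of the isogeny class (cell `b2b-bsdres`, prover B)

HONEST FRAMING (BSD rank-≤1 residual cell `b2b-bsdres`, home `run/shared/lean/b2b/bsd-rank1-residual/`,
unit `b2b-bsdres-x1b`, prover B = the independent patchwork, no Keller–Yin input; verbatim): the goal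
is to DELETE the COMBINATION-SHAPED residual classes for ALL analytic-rank `≤ 1` curves over `ℚ` —
"full BSD formula for every rank `≤ 1` curve in class C" assembled STRICTLY from published theorems —
so that the rank-`≤ 1` remainder becomes exactly the CONSTRUCTION-SHAPED classes, which are TYPED
(missing-input `Prop`s), NOT attempted; this is not "finishing BSD".

Theorems only (no definition, no new named fact); the class-X1 instances of the class-free file
`Typed/CasselsLowerBound.lean` (x11b, referee C85), plus Cassels' isogeny transport and the converse
chain of `X1MainConjecture.lean`.

**What this file records.** On X1 ∩ {r = 0} (odd good ANOMALOUS Eisenstein prime `p`, `L(E,1) ≠ 0`)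
the published record gives ONE inequality, `ord_p #Ш(E/ℚ) ≤ ord_p #Ш(E/ℚ)_an` (Wuthrich 2014
Prop. 21; `padicValNat_shaOrder_le_of_classX1`); the reverse inequality is Mazur's cyclotomic main
conjecture at `(E,p)` (kernel iff, `X1.mainConjecture_iff_bsdp`), unstated in print for the parity
type of these pairs. Two per-curve levers discharge it on the census: (L1/L8) `p ∤ #Ш(E'/ℚ)_an` for
some `ℚ`-isogenous `E'` (`bsdp_of_classX1_of_L_one_ne_zero_of_isIsogenous`), and — THIS FILE — when
`ord_p #Ш(E'/ℚ)_an ≤ 2` for some isogenous `E'`, the FINITE CERTIFICATE `p ∣ #Ш(E'/ℚ)` (one non-zero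
element of `Ш(E'/ℚ)` killed by `p`, e.g. the output of a `p`-isogeny descent), which by the
Cassels–Tate pairing (`#Ш` is a square: Cassels 1962 / Silverman AEC X.4.14, tree fact
`exists_casselsTate_pairing` = bsd.S18) forces `2 ≤ ord_p #Ш(E'/ℚ)`, hence equality, `BSD(E',p)`, and
by Cassels' isogeny invariance (Milne ADT I.7.3, tree fact `bsdRHS_eq_of_isIsogenous`) `BSD(E,p)`;
Mazur's main conjecture for `(E,p)` and `(E',p)` then follows by the converse chain (Wuthrich Thm. 16
+ Greenberg Thm. 4.1, `X1.mainConjecture_of_bsdp`).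

**Where it bites (census of record v5, `pub-bsdpct-3-g28/residue_classes_v5.tsv`, N < 2·10⁴,
complete; RESIDUAL-CASES.md §a.1 reading and §a.3 L8).** Of the 770 rank-`0` X1 pairs, 760 have
`p ∤ #Ш_an` (L1) and 8 more an isogenous curve with `p ∤ #Ш_an` (L8); the LAST TWO, `10406j1@3` and
`15059d1@3`, have `#Ш_an = 9` on every curve of their (two-curve) isogeny class. For both, the
prover's explicit `3`-isogeny descent (`HOME/b2b-bsdres-x1b/gen5/desc3iso/`: the Kummer map
`δ(P) = f_T(P) mod ℚ_v^{×3}` of the isogeny dual to `E → E/⟨T⟩`, `T ∈ E(ℚ)` of order `3`, with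
everywhere-local witnesses) exhibits a class of `Sel^{φ̂}(E'/ℚ) ⊂ ℚ^×/ℚ^{×3}` outside the image
`⟨δ(T)⟩` of `E(ℚ) = ⟨T⟩`, i.e. a non-zero element of `Ш(E'/ℚ)[φ̂] ⊂ Ш(E'/ℚ)[3]` for `E' = 10406j2`,
`15059d2` (classes `2` resp. `37`); so, modulo the lane's re-run of that finite computation, every
rank-`0` X1 pair of the census has a per-curve certificate from published theorems. NOT a class
theorem: the certificate is per curve; the class statement X1 ∩ {r = 0} stays typed
(`Typed/X1.lean`, `MazurMainConjectureOnX1TypeA`).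

**This file proves** (binders, all PUBLISHED named facts of the tree: `hCT` Cassels–Tate pairing
bsd.S18, `hW` Wuthrich 2014 Prop. 21, `hGZK` Gross–Zagier–Kolyvagin bsd.S17, `hmod` modularity /
`hmod'` modularity with integral Manin constant, `hCassels` Cassels 1965 / Milne ADT I.7.3, `hW16`
Wuthrich 2014 Thm. 16, `hGr` Greenberg 1999 Thm. 4.1):
* `X1.missingInputAt_of_casselsTate_of_dvd` — the typed input `Typed.X1.MissingInputAt W p` HOLDS at
  a rank-`0` pair with `ord_p #Ш_an ≤ 2` and `p ∣ #Ш`;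
* `X1.bsdp_of_casselsTate_of_pow_dvd`, `X1.bsdp_of_casselsTate_of_dvd`,
  `X1.bsdp_of_casselsTate_of_exists_torsion` — canonical shape
  `r_an ≤ 1 → ClassX1 W p → r_an = 0 → ord_p #Ш_an ≤ 2k → p^{2k-1} ∣ #Ш → BSDp W p` (and `k = 1`,
  and the one-element form `∃ x : Ш, x ≠ 0 ∧ p • x = 0`);
* `X1.bsdp_of_casselsTate_of_dvd_of_isIsogenous` (+ `_of_analyticRank_eq_zero`) — the certificate on
  an ISOGENOUS curve `E'` of class X1 gives `BSDp W p`;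
* `X1.mainConjecture_of_casselsTate_of_dvd` — Mazur's main conjecture for `(E,p)` (every datum) at
  such a pair.

References: Cassels 1962 [Cassels1962ArithmeticIV]; Silverman AEC X.4.14 [SilvermanAEC2009];
Wuthrich 2014 Prop. 21 / Thm. 16 [Wuthrich2014]; Greenberg LNM 1716 Thm. 4.1 [GreenbergLNM1716];
Milne ADT I.7.3 [MilneADT2006]; Miller 2011 Def. 1.1 [Miller2011LMS]; Schaefer–Stoll, Trans. AMS 356
(2004) (descent); cell files `b2b-bsdres-x1b/X1-B.md` §10, `X1-COMPARE.md` gen 5.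
-/

set_option autoImplicit false

noncomputable section

open scoped Classical MatrixGroups ModularForm

open CongruenceSubgroup WeierstrassCurve Literature.NumberTheory.EllipticCurves
  Literature.NumberTheory.EllipticCurves.ModularForms
  Literature.NumberTheory.EllipticCurves.Wuthrich2014
  Literature.NumberTheory.EllipticCurves.Rank1Residual.Typed

namespace Literature.NumberTheory.EllipticCurves.Rank1Residual

/-! ### The typed input of `Typed/X1.lean` is discharged by the finite certificate -/

/-- **X1 ∧ `r = 0`: the typed missing input HOLDS given the certificate.** For elliptic `W/ℚ` with
`ord_{s=1} L(E,s) = 0`, `#Ш(E/ℚ)_an` a rational of `p`-adic valuation `≤ 2`, and `p ∣ #Ш(E/ℚ)`, the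
typed input `Typed.X1.MissingInputAt W p` holds: its rank-`0` conjunct `MissingLowerBoundAt W p` by
Cassels–Tate squareness (`hCT`, `missingLowerBoundAt_of_casselsTate_of_pow_dvd`, `Ш` finite by
Gross–Zagier–Kolyvagin `hGZK`), its rank-`1` conjunct vacuously. No class hypothesis is needed.
[cite: SilvermanAEC2009, Thm. X.4.14] [cite: Miller2011LMS, Def. 1.1 (arXiv:1010.2431 p. 3)] -/
theorem X1.missingInputAt_of_casselsTate_of_dvd (hCT : exists_casselsTate_pairing (K := ℚ))
    (hGZK : rank_eq_analyticRank_of_analyticRank_le_one)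
    (W : WeierstrassCurve ℚ) [W.IsElliptic] (p : ℕ) [Fact p.Prime]
    (hr0 : W.analyticRank = 0) {q : ℚ} (hq : shaAn W = (q : ℂ)) (hv : padicValRat p q ≤ 2)
    (hdvd : p ∣ W.shaOrder) : Typed.X1.MissingInputAt W p :=
  ⟨fun _ => missingLowerBoundAt_of_casselsTate_of_pow_dvd W p hCT (hGZK W (by omega)).2 hq
      (k := 1) (by simpa using hv) (by simpa using hdvd),
    fun h1 => absurd h1 (by omega)⟩

/-! ### `BSD(E,p)` on X1 ∩ {r = 0} from the certificate (canonical shape of the cell) -/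

/-- **X1 ∧ `r = 0`, `ord_p #Ш_an ≤ 2k`, certificate `p^{2k-1} ∣ #Ш(E/ℚ)` ⇒ `BSD(E,p)`.** Canonical
shape `W.analyticRank ≤ 1 → ClassX1 W p → W.analyticRank = 0 → … → BSDp W p`. Upper half:
Wuthrich 2014 Prop. 21 (`hW`; on X1: `p` odd, good hence not additive, `E[p]` reducible hence Borel
image); lower half: Cassels–Tate squareness (`hCT`) and the certificate; `Ш` finite and rank `0` by
Gross–Zagier–Kolyvagin (`hGZK`); modularity (`hmod`) for `r_an = 0 ⇒ L(E,1) ≠ 0`. The class-free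
engine is `Typed.bsdp_of_wuthrich_of_casselsTate_of_pow_dvd`. [cite: Wuthrich2014, Prop. 21 (p. 400)]
[cite: SilvermanAEC2009, Thm. X.4.14] [cite: Miller2011LMS, §1 and Def. 1.1] -/
theorem X1.bsdp_of_casselsTate_of_pow_dvd (hCT : exists_casselsTate_pairing (K := ℚ))
    (hW : sha_dvd_analyticSha) (hGZK : rank_eq_analyticRank_of_analyticRank_le_one)
    (hmod : hasEntireLFunction_rat)
    (W : WeierstrassCurve ℚ) [W.IsElliptic] [W.IsGloballyMinimal] (p : ℕ) [Fact p.Prime]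
    (_hr : W.analyticRank ≤ 1) (hX : ClassX1 W p) (hr0 : W.analyticRank = 0)
    {q : ℚ} (hq : shaAn W = (q : ℂ)) {k : ℕ} (hv : padicValRat p q ≤ 2 * k)
    (hdvd : p ^ (2 * k - 1) ∣ W.shaOrder) : BSDp W p :=
  have hX' := isClassX1_of_classX1 hX
  bsdp_of_wuthrich_of_casselsTate_of_pow_dvd W p hCT hW hGZK hmod hX'.two_ne hr0
    hX'.not_hasAdditiveReduction (Or.inl hX'.not_hasIrreducibleModPGaloisRep) hq hv hdvd

/-- **The `k = 1` case (the census case `#Ш_an = 9`, `p = 3`): X1 ∧ `r = 0`, `ord_p #Ш_an ≤ 2`, and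
ONE certificate `p ∣ #Ш(E/ℚ)` ⇒ `BSD(E,p)`.** [cite: Wuthrich2014, Prop. 21 (p. 400)]
[cite: SilvermanAEC2009, Thm. X.4.14] [cite: Miller2011LMS, §1 and Def. 1.1] -/
theorem X1.bsdp_of_casselsTate_of_dvd (hCT : exists_casselsTate_pairing (K := ℚ))
    (hW : sha_dvd_analyticSha) (hGZK : rank_eq_analyticRank_of_analyticRank_le_one)
    (hmod : hasEntireLFunction_rat)
    (W : WeierstrassCurve ℚ) [W.IsElliptic] [W.IsGloballyMinimal] (p : ℕ) [Fact p.Prime]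
    (hr : W.analyticRank ≤ 1) (hX : ClassX1 W p) (hr0 : W.analyticRank = 0)
    {q : ℚ} (hq : shaAn W = (q : ℂ)) (hv : padicValRat p q ≤ 2) (hdvd : p ∣ W.shaOrder) :
    BSDp W p :=
  X1.bsdp_of_casselsTate_of_pow_dvd hCT hW hGZK hmod W p hr hX hr0 hq (k := 1) (by simpa using hv)
    (by simpa using hdvd)

/-- **One-element form of the certificate:** X1 ∧ `r = 0`, `ord_p #Ш_an ≤ 2`, and a non-zero element
of `Ш(E/ℚ)` killed by `p` (what a `p`-descent with `Sel^{(p)}(E/ℚ) ⊋ E(ℚ)/pE(ℚ)`, or a `p`-isogeny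
descent with `Sel^{φ̂} ⊋ δ(E(ℚ))`, delivers) ⇒ `BSD(E,p)` (`Typed.dvd_shaOrder_of_exists_torsion`).
[cite: Wuthrich2014, Prop. 21 (p. 400)] [cite: SilvermanAEC2009, Thm. X.4.14]
[cite: Miller2011LMS, §1 and Def. 1.1] -/
theorem X1.bsdp_of_casselsTate_of_exists_torsion (hCT : exists_casselsTate_pairing (K := ℚ))
    (hW : sha_dvd_analyticSha) (hGZK : rank_eq_analyticRank_of_analyticRank_le_one)
    (hmod : hasEntireLFunction_rat)
    (W : WeierstrassCurve ℚ) [W.IsElliptic] [W.IsGloballyMinimal] (p : ℕ) [Fact p.Prime]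
    (hr : W.analyticRank ≤ 1) (hX : ClassX1 W p) (hr0 : W.analyticRank = 0)
    {q : ℚ} (hq : shaAn W = (q : ℂ)) (hv : padicValRat p q ≤ 2)
    (hx : ∃ x : W.sha, x ≠ 0 ∧ p • x = 0) : BSDp W p :=
  X1.bsdp_of_casselsTate_of_dvd hCT hW hGZK hmod W p hr hX hr0 hq hv
    (dvd_shaOrder_of_exists_torsion W p hx)

/-! ### The certificate on an ISOGENOUS curve (Cassels' invariance of the BSD quotient) -/

/-- **X1 ∧ `r = 0`, up to isogeny:** if `W ∼ W'` over `ℚ` (globally minimal models), `(W',p)` is of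
class X1, `L(W,1) ≠ 0`, `#Ш(W'/ℚ)_an` is a rational of `p`-adic valuation `≤ 2`, and `p ∣ #Ш(W'/ℚ)`
(the certificate ON `W'`), then `BSDp W p`: `BSD(W',p)` by `X1.bsdp_of_casselsTate_of_dvd`
(`L(W',1) = L(W,1) ≠ 0` by Faltings), transported by Cassels' isogeny invariance (`hCassels`,
`Wuthrich2014.bsdp_of_isIsogenous`). Census instances: `10406j1@3` via `10406j2`, `15059d1@3` via
`15059d2`. [cite: Wuthrich2014, Prop. 21 (p. 400)] [cite: SilvermanAEC2009, Thm. X.4.14]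
[cite: MilneADT2006, Thm. I.7.3 and Remark I.7.4] [cite: Miller2011LMS, §1 and Def. 1.1] -/
theorem X1.bsdp_of_casselsTate_of_dvd_of_isIsogenous (hCT : exists_casselsTate_pairing (K := ℚ))
    (hW : sha_dvd_analyticSha) (hGZK : rank_eq_analyticRank_of_analyticRank_le_one)
    (hmod : hasEntireLFunction_rat) (hCassels : bsdRHS_eq_of_isIsogenous)
    (W W' : WeierstrassCurve ℚ) [W.IsElliptic] [W'.IsElliptic] [W.IsGloballyMinimal]
    [W'.IsGloballyMinimal] (hiso : IsIsogenous W W') (p : ℕ) [Fact p.Prime]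
    (_hr : W.analyticRank ≤ 1) (hX' : ClassX1 W' p) (hL : W.entireLFunction 1 ≠ 0)
    {q' : ℚ} (hq' : shaAn W' = (q' : ℂ)) (hv' : padicValRat p q' ≤ 2) (hdvd' : p ∣ W'.shaOrder) :
    BSDp W p := by
  have hL' : W'.entireLFunction 1 ≠ 0 := by
    rwa [← entireLFunction_eq_of_isIsogenous' hiso]
  have hr0' : W'.analyticRank = 0 := analyticRank_eq_zero_of_entireLFunction_one_ne_zero W' hL'
  have h' : BSDp W' p :=
    X1.bsdp_of_casselsTate_of_dvd hCT hW hGZK hmod W' p (by omega) hX' hr0' hq' hv' hdvd'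
  obtain ⟨-, hfin'⟩ := hGZK W' (by rw [hr0']; exact zero_le_one)
  have hlead : W'.leadingLCoeff ≠ 0 := by
    rwa [W'.leadingLCoeff_eq_of_analyticRank_eq_zero hr0']
  exact bsdp_of_isIsogenous hCassels hiso hfin' hlead h'

/-- **The same with `W.analyticRank = 0` in place of `L(W,1) ≠ 0`** (modularity `hmod` converts; the
cell's canonical shape `W.analyticRank ≤ 1 → W.analyticRank = 0 → … → BSDp W p`), and with the
one-element form of the certificate on `W'`. [cite: Wuthrich2014, Prop. 21 (p. 400)]
[cite: SilvermanAEC2009, Thm. X.4.14] [cite: MilneADT2006, Thm. I.7.3] [cite: BCDTJAMS2001, Theorem A] -/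
theorem X1.bsdp_of_casselsTate_of_exists_torsion_of_isIsogenous
    (hCT : exists_casselsTate_pairing (K := ℚ))
    (hW : sha_dvd_analyticSha) (hGZK : rank_eq_analyticRank_of_analyticRank_le_one)
    (hmod : hasEntireLFunction_rat) (hCassels : bsdRHS_eq_of_isIsogenous)
    (W W' : WeierstrassCurve ℚ) [W.IsElliptic] [W'.IsElliptic] [W.IsGloballyMinimal]
    [W'.IsGloballyMinimal] (hiso : IsIsogenous W W') (p : ℕ) [Fact p.Prime]
    (hr : W.analyticRank ≤ 1) (hX' : ClassX1 W' p) (hr0 : W.analyticRank = 0)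
    {q' : ℚ} (hq' : shaAn W' = (q' : ℂ)) (hv' : padicValRat p q' ≤ 2)
    (hx' : ∃ x : W'.sha, x ≠ 0 ∧ p • x = 0) : BSDp W p :=
  X1.bsdp_of_casselsTate_of_dvd_of_isIsogenous hCT hW hGZK hmod hCassels W W' hiso p hr hX'
    ((W.analyticRank_eq_zero_iff_holds (hmod W)).mp hr0) hq' hv'
    (dvd_shaOrder_of_exists_torsion W' p hx')

/-! ### Mazur's main conjecture at such a pair (the converse chain of `X1MainConjecture.lean`) -/

/-- **Mazur's main conjecture for `(E,p)` at a rank-`0` X1 pair with `ord_p #Ш_an ≤ 2` and the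
certificate `p ∣ #Ш(E/ℚ)`** (every datum `(κ, γ, f, ϖ, D)`; Néron normalisation — literally the body
of prover A's `MazurMainConjecture W p`): `BSD(E,p)` by `X1.bsdp_of_casselsTate_of_dvd`, then the
converse chain Wuthrich Thm. 16 (`hW16`) + Greenberg Thm. 4.1 (`hGr`) (`X1.mainConjecture_of_bsdp`).
On the census this makes Mazur's (MC) a theorem of the published record, modulo the lane's re-run of
the finite descent, at `(10406j1, 3)`, `(10406j2, 3)`, `(15059d1, 3)`, `(15059d2, 3)` — anomalous
Eisenstein pairs of parity type A with `3 ∣ #Ш`, outside Greenberg–Vatsal 2000 and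
Castella–Grossi–Skinner 2025. [cite: GreenbergLNM1716, Thm. 4.1 and §5 (closing examples)]
[cite: Wuthrich2014, Thm. 16 (p. 393) and Prop. 21 (p. 400)] [cite: SilvermanAEC2009, Thm. X.4.14] -/
theorem X1.mainConjecture_of_casselsTate_of_dvd (hCT : exists_casselsTate_pairing (K := ℚ))
    (hW : sha_dvd_analyticSha) (hW16 : charIdeal_dvd_padicLFunction)
    (hGr : greenberg_charValue_rankZero) (hmod' : nonempty_modularParametrizationData)
    (hmod : hasEntireLFunction_rat) (hGZK : rank_eq_analyticRank_of_analyticRank_le_one)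
    (W : WeierstrassCurve ℚ) [W.IsElliptic] [W.IsGloballyMinimal] (p : ℕ) [Fact p.Prime]
    (hX1 : ClassX1 W p) (hr0 : W.analyticRank = 0)
    {q : ℚ} (hq : shaAn W = (q : ℂ)) (hv : padicValRat p q ≤ 2) (hdvd : p ∣ W.shaOrder)
    {κ : ZpExtension ℚ p} {γ : Field.absoluteGaloisGroup ℚ} {N : ℕ} [NeZero N]
    {f : CuspForm (Gamma0 N) 2} (hκ : κ.IsCyclotomic) (hγ : κ.IsTopGenerator γ)
    (hγ' : IsCyclotomicVariable p γ) (hf : IsNewformOf W f) (D : W.SelmerDualData κ γ) (ϖ : ℚ)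
    (hϖ : (ϖ : ℝ) * W.realPeriodRat = plusPeriod f) :
    D.IsTorsion ∧ ∃ g : IwasawaAlgebra p, D.charIdeal = Ideal.span {g} ∧
      iwasawaToPowerSeries p g =
        PowerSeries.C ((ϖ : ℚ) : ℚ_[p]) * padicLFunction f (unitRoot W p : ℚ_[p]) :=
  X1.mainConjecture_of_bsdp hW16 hGr hmod' hGZK W p hX1 hr0
    (X1.bsdp_of_casselsTate_of_dvd hCT hW hGZK hmod W p (by omega) hX1 hr0 hq hv hdvd)
    hκ hγ hγ' hf D ϖ hϖ

end Literature.NumberTheory.EllipticCurves.Rank1Residual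

end
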